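import Mathlib.LinearAlgebra.BilinearMap
import Mathlib.Data.Matrix.Mul
import Mathlib.LinearAlgebra.Matrix.DotProduct
import Mathlib.FieldTheory.Finite.Basic
import Mathlib.Data.Real.Basic
import Literature.Combinatorics.Additive.TripleProductProperty
import Literature.Computability.AlgebraicComplexity.CohnUmansTPP
import HarnessLib

/-!
# Cohn–Umans 2003, Prop. 7.1 / Cor. 7.2–7.3: the Heisenberg-type groups `(x, y, α)` and their TPP triples

Topic `Literature/Computability/AlgebraicComplexity` (group-theoretic matrix multiplication), namespace
`Literature.Computability.AlgebraicComplexity`; companion of `CohnUmansTPP.lean` (`RealizesTPP`).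

H. Cohn, C. Umans, *A group-theoretic approach to fast matrix multiplication*, FOCS 2003 = arXiv:math/0307321, §7.1
"Solvable groups" (Proposition 13, Corollaries 14–15 of the arXiv text, pp. 8–9): "Let `F` be a field, and `⟨,⟩` a
symmetric bilinear form on `Fⁿ`. Define multiplication in `G = {(x,y,α) : x,y ∈ Fⁿ, α ∈ F}` via
`(x,y,α)(u,v,β) = (x+u, y+v, α+β+2⟨u,y⟩)`, and define the three subgroups `H₁ = {(x,0,0)}`, `H₂ = {(0,y,0)}`, and
`H₃ = {(z,z,⟨z,z⟩)}`. **Proposition 7.1.** If the only element `z ∈ Fⁿ` satisfying `⟨z,z⟩ = 0` is `z = 0`, then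
`H₁`, `H₂`, and `H₃` satisfy the triple product property. *Proof.* We simply need to check that `H₃` avoids all
elements of the form `(x,0,0)(0,y,0) = (x,y,0)`, except when `x = y = 0`. The only way such an element can be in
`H₃` … is if `x = y = z` and `⟨z,z⟩ = 0`. That means `z = 0` and thus `x = y = 0`, as desired." "**Corollary 7.2.**
… with `F = ℝ`, and `⟨,⟩` the standard inner product, the Lie group `G` has Lie pseudo-exponent at most `2 + 1/n`."
"**Corollary 7.3.** … with `F = 𝔽_q` of odd characteristic, `n = 2`, and `⟨x,y⟩ = x₁y₁ − wx₂y₂` for some `w ∈ F` that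
is not a square, the finite group `G` has pseudo-exponent at most `2.5`. *Proof.* Note that `⟨z,z⟩ = 0` implies
`z₁² = wz₂²`, which by our choice of `w` can only happen when `z = 0` … The group has order `q⁵`, and the three
subgroups have size `q²`, leading to a pseudo-exponent bound of `2.5` as claimed."

## Lean rendering
* `Heis B` — the group on `V × V × F` with the printed law, for any bilinear `B : V →ₗ[F] V →ₗ[F] F` over a
  commutative ring (symmetry is needed only for `H₃` to be a subgroup); `inlX`, `inlY` (`H₁`, `H₂`) and `diagZ`
  (`H₃`, for symmetric `B`) as homomorphisms from `Multiplicative V`.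
* `CohnUmans2003_prop71` — the printed TPP check in subgroup form: `(x,0,0)(0,y,0) = (z,z,⟨z,z⟩)` forces
  `x = y = z = 0` when `B` is anisotropic; `CohnUmans2003_prop71_realizes` — for finite `V`:
  `Heis B` realizes `⟨|V|, |V|, |V|⟩` (tree's `RealizesTPP`, right-quotient TPP; for subgroups the two forms agree,
  `tpp_image_of_homs'`), and `card_heis : |Heis B| = |V|²·|F|`.
* `CohnUmans2003_cor72` — `F = ℝ`, standard inner product on `ℝⁿ` (anisotropic): the TPP (the dimension count
  `(2n+1)/n = 2 + 1/n` is not restated).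
* `CohnUmans2003_cor73` — `F` a finite field of odd characteristic, `V = F²`, `⟨x,y⟩ = x₁y₁ − wx₂y₂` with `w` a
  non-square: `Heis` realizes `⟨q², q², q²⟩` in a group of order `q⁵` (`3 log q⁵ / log q⁶ = 2.5`); a non-square exists
  (`FiniteField.exists_nonsquare`).

## References
* H. Cohn, C. Umans, FOCS 2003, 438–449; arXiv:math/0307321, §7.1: Prop. 7.1, Cor. 7.2, Cor. 7.3 (Prop. 13,
  Cor. 14–15 of the arXiv text, pp. 8–9). [CohnUmans2003]
-/

namespace Literature.Computability.AlgebraicComplexity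

open Finset Literature.Combinatorics.Additive

/-- CU's group `G = {(x, y, α) : x, y ∈ V, α ∈ F}` attached to a bilinear form `B` on `V`
(`(x,y,α)(u,v,β) = (x+u, y+v, α+β+2⟨u,y⟩)`). [cite: CohnUmans2003, §7.1 (before Prop. 7.1)] -/
@[ext]
structure Heis {F V : Type*} [CommRing F] [AddCommGroup V] [Module F V] (B : V →ₗ[F] V →ₗ[F] F) where
  /-- first vector component `x` -/
  x : V
  /-- second vector component `y` -/
  y : V
  /-- scalar component `α` -/
  a : F

namespace Heis

variable {F V : Type*} [CommRing F] [AddCommGroup V] [Module F V] {B : V →ₗ[F] V →ₗ[F] F}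

/-- `(x,y,α)(u,v,β) = (x+u, y+v, α+β+2⟨u,y⟩)`. [cite: CohnUmans2003, §7.1 (before Prop. 7.1)] -/
instance : Mul (Heis B) where
  mul g h := ⟨g.x + h.x, g.y + h.y, g.a + h.a + 2 * B h.x g.y⟩

/-- The identity `(0,0,0)`. [folklore] -/
instance : One (Heis B) where one := ⟨0, 0, 0⟩

/-- `(x,y,α)⁻¹ = (−x, −y, −α + 2⟨x,y⟩)`. [folklore] -/
instance : Inv (Heis B) where
  inv g := ⟨-g.x, -g.y, -g.a + 2 * B g.x g.y⟩

/-- Component formulas of the law `(x,y,α)(u,v,β) = (x+u, y+v, α+β+2⟨u,y⟩)`. [cite: CohnUmans2003, §7.1] -/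
@[simp] theorem mul_x (g h : Heis B) : (g * h).x = g.x + h.x := rfl
/-- Component formulas of the law `(x,y,α)(u,v,β) = (x+u, y+v, α+β+2⟨u,y⟩)`. [cite: CohnUmans2003, §7.1] -/
@[simp] theorem mul_y (g h : Heis B) : (g * h).y = g.y + h.y := rfl
/-- Component formulas of the law `(x,y,α)(u,v,β) = (x+u, y+v, α+β+2⟨u,y⟩)`. [cite: CohnUmans2003, §7.1] -/
@[simp] theorem mul_a (g h : Heis B) : (g * h).a = g.a + h.a + 2 * B h.x g.y := rfl
/-- Components of the identity `(0,0,0)`. [cite: CohnUmans2003, §7.1 (group law before Prop. 7.1)] -/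
@[simp] theorem one_x : (1 : Heis B).x = 0 := rfl
/-- Components of the identity `(0,0,0)`. [cite: CohnUmans2003, §7.1 (group law before Prop. 7.1)] -/
@[simp] theorem one_y : (1 : Heis B).y = 0 := rfl
/-- Components of the identity `(0,0,0)`. [cite: CohnUmans2003, §7.1 (group law before Prop. 7.1)] -/
@[simp] theorem one_a : (1 : Heis B).a = 0 := rfl
/-- Components of the inverse `(x,y,α)⁻¹ = (−x, −y, −α + 2⟨x,y⟩)`. [cite: CohnUmans2003, §7.1 (group law before Prop. 7.1)] -/
@[simp] theorem inv_x (g : Heis B) : g⁻¹.x = -g.x := rfl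
/-- Components of the inverse `(x,y,α)⁻¹ = (−x, −y, −α + 2⟨x,y⟩)`. [cite: CohnUmans2003, §7.1 (group law before Prop. 7.1)] -/
@[simp] theorem inv_y (g : Heis B) : g⁻¹.y = -g.y := rfl
/-- Components of the inverse `(x,y,α)⁻¹ = (−x, −y, −α + 2⟨x,y⟩)`. [cite: CohnUmans2003, §7.1 (group law before Prop. 7.1)] -/
@[simp] theorem inv_a (g : Heis B) : g⁻¹.a = -g.a + 2 * B g.x g.y := rfl

/-- `G` is a group (associativity is bilinearity of `⟨,⟩`). [cite: CohnUmans2003, §7.1 (before Prop. 7.1)] -/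
instance : Group (Heis B) where
  mul_assoc g h k := by
    ext
    · simp [add_assoc]
    · simp [add_assoc]
    · simp only [mul_a, mul_x, mul_y, map_add, LinearMap.add_apply]; ring
  one_mul g := by
    ext <;> simp
  mul_one g := by
    ext <;> simp
  inv_mul_cancel g := by
    ext
    · simp
    · simp
    · simp only [mul_a, inv_a, inv_y, map_neg, one_a]; ring

/-- `|G| = |V|²·|F|` via `G ≃ V × V × F`. [cite: CohnUmans2003, Cor. 7.3 (proof: "The group has order q⁵")] -/
def equivProd : Heis B ≃ V × V × F where
  toFun g := (g.x, g.y, g.a)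
  invFun p := ⟨p.1, p.2.1, p.2.2⟩
  left_inv _ := rfl
  right_inv _ := rfl

/-- Finiteness transported along `equivProd`. [folklore] -/
instance [Fintype V] [Fintype F] : Fintype (Heis B) := Fintype.ofEquiv _ equivProd.symm

/-- Decidable equality transported along `equivProd`. [folklore] -/
instance [DecidableEq V] [DecidableEq F] : DecidableEq (Heis B) := equivProd.decidableEq

/-- "The group has order `q⁵`": `|G| = |V|·|V|·|F|`. [cite: CohnUmans2003, Cor. 7.3 (proof)] -/
theorem card_heis [Fintype V] [Fintype F] :
    Fintype.card (Heis B) = Fintype.card V * (Fintype.card V * Fintype.card F) := by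
  rw [Fintype.card_congr (equivProd (B := B)), Fintype.card_prod, Fintype.card_prod]

/-! ## The three subgroups as homomorphic images -/

/-- `H₁ = {(x, 0, 0)}`. [cite: CohnUmans2003, §7.1 (before Prop. 7.1)] -/
def inlX : Multiplicative V →* Heis B where
  toFun x := ⟨x.toAdd, 0, 0⟩
  map_one' := rfl
  map_mul' x x' := by ext <;> simp

/-- `H₂ = {(0, y, 0)}`. [cite: CohnUmans2003, §7.1 (before Prop. 7.1)] -/
def inlY : Multiplicative V →* Heis B where
  toFun y := ⟨0, y.toAdd, 0⟩
  map_one' := rfl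
  map_mul' y y' := by ext <;> simp

/-- `H₃ = {(z, z, ⟨z,z⟩)}` — a subgroup because `⟨,⟩` is symmetric. [cite: CohnUmans2003, §7.1 (before Prop. 7.1)] -/
def diagZ (hB : ∀ u v : V, B u v = B v u) : Multiplicative V →* Heis B where
  toFun z := ⟨z.toAdd, z.toAdd, B z.toAdd z.toAdd⟩
  map_one' := by ext <;> simp
  map_mul' z z' := by
    ext
    · simp
    · simp
    · simp only [toAdd_mul, map_add, LinearMap.add_apply, mul_a]
      rw [hB (Multiplicative.toAdd z) (Multiplicative.toAdd z')]
      ring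

/-! ## Prop. 7.1: the TPP -/

/-- **Cohn–Umans 2003, Prop. 7.1** (subgroup form of the TPP): if `⟨z,z⟩ = 0` only for `z = 0`, then
`(x,0,0)(0,y,0) = (z,z,⟨z,z⟩)` forces `x = y = z = 0` ("`H₃` avoids all elements of the form `(x,0,0)(0,y,0) = (x,y,0)`,
except when `x = y = 0`"). [cite: CohnUmans2003, Prop. 7.1 (Prop. 13 of the arXiv text, p. 9)] -/
theorem CohnUmans2003_prop71 (hB : ∀ u v : V, B u v = B v u) (hanis : ∀ z : V, B z z = 0 → z = 0)
    (x y z : Multiplicative V) (h : inlX (B := B) x * inlY y = diagZ hB z) : x = 1 ∧ y = 1 ∧ z = 1 := by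
  have hx : x.toAdd = z.toAdd := by simpa [inlX, inlY, diagZ] using congrArg Heis.x h
  have hy : y.toAdd = z.toAdd := by simpa [inlX, inlY, diagZ] using congrArg Heis.y h
  have ha : (0 : F) = B z.toAdd z.toAdd := by simpa [inlX, inlY, diagZ] using congrArg Heis.a h
  have hz : z.toAdd = 0 := hanis _ ha.symm
  refine ⟨?_, ?_, ?_⟩
  · exact toAdd_eq_zero.1 (hx.trans hz)
  · exact toAdd_eq_zero.1 (hy.trans hz)
  · exact toAdd_eq_zero.1 hz

/-- For subgroups (`Q(Hᵢ) = Hᵢ`) the tree's right-quotient TPP of the three images follows from the subgroup form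
"`h₁h₂ = h₃` forces `hᵢ = 1`". [cite: CohnUmans2003, Def. 2.1 (remark after it)] -/
private theorem tpp_image_of_homs' {K G : Type*} [Group K] [Group G] [Fintype K] [DecidableEq G]
    (φ₁ φ₂ φ₃ : K →* G) (h : ∀ a b c : K, φ₁ a * φ₂ b = φ₃ c → a = 1 ∧ b = 1 ∧ c = 1) :
    TripleProductProperty (univ.image φ₁) (univ.image φ₂) (univ.image φ₃) := by
  intro s hs s' hs' t ht t' ht' u hu u' hu' heq
  obtain ⟨a, -, rfl⟩ := mem_image.1 hs
  obtain ⟨a', -, rfl⟩ := mem_image.1 hs'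
  obtain ⟨b, -, rfl⟩ := mem_image.1 ht
  obtain ⟨b', -, rfl⟩ := mem_image.1 ht'
  obtain ⟨c, -, rfl⟩ := mem_image.1 hu
  obtain ⟨c', -, rfl⟩ := mem_image.1 hu'
  have key : φ₁ (a * a'⁻¹) * φ₂ (b * b'⁻¹) = φ₃ (c' * c⁻¹) := by
    rw [map_mul, map_inv, map_mul, map_inv, map_mul, map_inv]
    calc φ₁ a * (φ₁ a')⁻¹ * (φ₂ b * (φ₂ b')⁻¹)
        = φ₁ a * (φ₁ a')⁻¹ * (φ₂ b * (φ₂ b')⁻¹) * (φ₃ c * (φ₃ c')⁻¹) * (φ₃ c * (φ₃ c')⁻¹)⁻¹ := by group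
      _ = φ₃ c' * (φ₃ c)⁻¹ := by rw [heq]; group
  obtain ⟨h1, h2, h3⟩ := h _ _ _ key
  exact ⟨by rw [mul_inv_eq_one.1 h1], by rw [mul_inv_eq_one.1 h2], by rw [mul_inv_eq_one.1 h3]⟩

/-- **Cohn–Umans 2003, Prop. 7.1** for finite `V`: `G` realizes `⟨|V|, |V|, |V|⟩` through `H₁, H₂, H₃`.
[cite: CohnUmans2003, Prop. 7.1 (Prop. 13 of the arXiv text, p. 9)] -/
theorem CohnUmans2003_prop71_realizes [Fintype V] [DecidableEq V] [DecidableEq F]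
    (hB : ∀ u v : V, B u v = B v u) (hanis : ∀ z : V, B z z = 0 → z = 0) :
    RealizesTPP (Heis B) (Fintype.card V) (Fintype.card V) (Fintype.card V) := by
  have h1 : Function.Injective (inlX (B := B)) := fun x x' h => by
    simpa [inlX] using congrArg Heis.x h
  have h2 : Function.Injective (inlY (B := B)) := fun y y' h => by
    simpa [inlY] using congrArg Heis.y h
  have h3 : Function.Injective (diagZ (B := B) hB) := fun z z' h => by
    simpa [diagZ] using congrArg Heis.x h
  refine ⟨univ.image inlX, univ.image inlY, univ.image (diagZ hB), ?_, ?_, ?_,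
    tpp_image_of_homs' _ _ _ (CohnUmans2003_prop71 hB hanis)⟩
  · rw [card_image_of_injective _ h1, card_univ, Fintype.card_multiplicative]
  · rw [card_image_of_injective _ h2, card_univ, Fintype.card_multiplicative]
  · rw [card_image_of_injective _ h3, card_univ, Fintype.card_multiplicative]

end Heis

/-! ## Cor. 7.2: `F = ℝ`, the standard inner product (the real Heisenberg group) -/

/-- The standard inner product on `ℝⁿ` as a bilinear map. [folklore] -/
noncomputable def dotBilin (n : ℕ) : (Fin n → ℝ) →ₗ[ℝ] (Fin n → ℝ) →ₗ[ℝ] ℝ :=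
  LinearMap.mk₂ ℝ (fun x y => dotProduct x y) (fun x x' y => by simp [add_dotProduct])
    (fun c x y => by simp) (fun x y y' => by simp [dotProduct_add]) (fun c x y => by simp)

/-- **Cohn–Umans 2003, Cor. 7.2** (TPP part): in the real Heisenberg-type group of `ℝⁿ` with the standard inner
product, `H₁, H₂, H₃` satisfy the triple product property (subgroup form), since `⟨z,z⟩ = 0 ⇒ z = 0` over `ℝ`.
[cite: CohnUmans2003, Cor. 7.2 (Cor. 14 of the arXiv text, p. 9)] -/
theorem CohnUmans2003_cor72 (n : ℕ) (x y z : Multiplicative (Fin n → ℝ))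
    (h : Heis.inlX (B := dotBilin n) x * Heis.inlY y = Heis.diagZ (fun u v => by simp [dotBilin, dotProduct_comm]) z) :
    x = 1 ∧ y = 1 ∧ z = 1 :=
  Heis.CohnUmans2003_prop71 _ (fun z hz => dotProduct_self_eq_zero.1 (by simpa [dotBilin] using hz)) x y z h

/-! ## Cor. 7.3: `F = 𝔽_q` odd, `n = 2`, `⟨x,y⟩ = x₁y₁ − w x₂y₂` -/

/-- The form `⟨x,y⟩ = x₁y₁ − w x₂y₂` on `F²`. [cite: CohnUmans2003, Cor. 7.3 (Cor. 15 of the arXiv text, p. 9)] -/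
def diagForm {F : Type*} [Field F] (w : F) : (Fin 2 → F) →ₗ[F] (Fin 2 → F) →ₗ[F] F :=
  LinearMap.mk₂ F (fun x y => x 0 * y 0 - w * (x 1 * y 1))
    (fun x x' y => by simp only [Pi.add_apply]; ring) (fun c x y => by simp only [Pi.smul_apply, smul_eq_mul]; ring)
    (fun x y y' => by simp only [Pi.add_apply]; ring) (fun c x y => by simp only [Pi.smul_apply, smul_eq_mul]; ring)

/-- "`⟨z,z⟩ = 0` implies `z₁² = wz₂²`, which by our choice of `w` can only happen when `z = 0`".
[cite: CohnUmans2003, Cor. 7.3 (proof)] -/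
theorem diagForm_anisotropic {F : Type*} [Field F] {w : F} (hw : ¬ IsSquare w) (z : Fin 2 → F)
    (hz : diagForm w z z = 0) : z = 0 := by
  have h0 : z 0 * z 0 - w * (z 1 * z 1) = 0 := by simpa [diagForm] using hz
  have hz1 : z 1 = 0 := by
    by_contra h1
    apply hw
    refine ⟨z 0 / z 1, ?_⟩
    field_simp
    linear_combination -h0
  have hz0 : z 0 = 0 := by
    rw [hz1, mul_zero, mul_zero, sub_zero] at h0
    exact mul_self_eq_zero.1 h0
  funext i
  fin_cases i
  · exact hz0
  · exact hz1

/-- **Cohn–Umans 2003, Cor. 7.3**: for a finite field `F` (`q = |F|`) and a non-square `w ∈ F`, the group `G` of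
`⟨x,y⟩ = x₁y₁ − wx₂y₂` on `F²` realizes `⟨q², q², q²⟩`, and `|G| = q⁵` ("pseudo-exponent at most
`3 log q⁵ / log q⁶ = 2.5`"). In odd characteristic a non-square exists (`FiniteField.exists_nonsquare`).
[cite: CohnUmans2003, Cor. 7.3 (Cor. 15 of the arXiv text, p. 9)] -/
theorem CohnUmans2003_cor73 {F : Type*} [Field F] [Fintype F] [DecidableEq F] {w : F} (hw : ¬ IsSquare w) :
    RealizesTPP (Heis (diagForm w)) (Fintype.card F ^ 2) (Fintype.card F ^ 2) (Fintype.card F ^ 2) ∧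
      Fintype.card (Heis (diagForm w)) = Fintype.card F ^ 5 := by
  have hsymm : ∀ u v : Fin 2 → F, diagForm w u v = diagForm w v u := fun u v => by
    simp only [diagForm, LinearMap.mk₂_apply]; ring
  have hcard : Fintype.card (Fin 2 → F) = Fintype.card F ^ 2 := by simp
  refine ⟨?_, ?_⟩
  · have := Heis.CohnUmans2003_prop71_realizes hsymm (fun z hz => diagForm_anisotropic hw z hz)
    rwa [hcard] at this
  · rw [Heis.card_heis, hcard]; ring

/-- Cor. 7.3 is non-vacuous: a finite field of odd characteristic has a non-square.
[cite: CohnUmans2003, Cor. 7.3 (Cor. 15 of the arXiv text, p. 9)] -/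
theorem CohnUmans2003_cor73_exists (F : Type*) [Field F] [Fintype F] [DecidableEq F] (hF : ringChar F ≠ 2) :
    ∃ w : F, RealizesTPP (Heis (diagForm w)) (Fintype.card F ^ 2) (Fintype.card F ^ 2) (Fintype.card F ^ 2) ∧
      Fintype.card (Heis (diagForm w)) = Fintype.card F ^ 5 := by
  obtain ⟨w, hw⟩ := FiniteField.exists_nonsquare hF
  exact ⟨w, CohnUmans2003_cor73 hw⟩

end Literature.Computability.AlgebraicComplexity
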